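import Literature.Computability.AlgebraicComplexity.ApproximativeRootClosure
import Summits.ValiantsHypothesis.ValiantsHypothesis.Theorems.VPBoundarySquareRootsToolbox
import HarnessLib

/-!
# Bürgisser's Newton core over `F((ε))`, data-explicit (road E1, stage 2 / S2)

Helper file for route `VPBoundarySquare` (series O-L3-12 «roots are presentable»). The tree's
`exists_polyOrdGE_of_factorization` (Bürgisser 2004, Prop. 3.4) hides its constants behind an
`∃ h`; this self-contained twin of its PRECISION half exposes them: with `c = φ(0)`, `ε`,
`c₀ = H(0, c + ε)` and the EXACT slope `ξ = ∂_y H(0, c + ε) = ε^e · unit` (so `ξ⁻¹ = O(ε^{-e})`),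
the degree-`d` truncation of the `d`-th slow Newton iterate `z ↦ z - ξ⁻¹ (H(x, z + ε) - c₀)` from
`z_0 = c` is `φ + O(ε)` (`newton_truncation_polyOrdGE`); `G(x, y) = H(x, y + ε) - c₀` is packaged
as a polynomial in `y` with `F[[ε]][x]` coefficients and the `y`-degree of `H`
(`exists_perturbedPolynomial`) for the pole calculus of `VPBoundarySquareRootsToolbox` (stage S3).
Proof = the tree's (comparison iterate `φ - ε + ε v_d`, uniqueness of approximate roots), the
slope read through `optionEquivLeft ∘ pderiv none = derivative ∘ optionEquivLeft`; the tree's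
public Newton lemmas are reused by name. No definitions, no facts.
[cite: Burgisser2004Factors, Prop. 3.4, Remark 1(1) (arXiv:1812.06828 §3.2);
BhargavDwivediSaxena2024, Lemma 4.4]
-/
noncomputable section

set_option linter.dupNamespace false

namespace Summit.ValiantsHypothesis.ValiantsHypothesis.Theorems.VPBoundarySquareRootsNewtonCore

open MvPolynomial Finset Literature.Computability.AlgebraicComplexity
open Summit.ValiantsHypothesis.ValiantsHypothesis.Theorems.VPBoundarySquareRootsToolbox

universe u v w

section OptionEquiv
variable {L : Type u} [CommRing L] {β : Type v}

/-- `optionEquivLeft` turns `∂/∂y` into the derivative (twin of the `Limits` lemma). [folklore] -/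
theorem optionEquivLeft_pderiv_none' (f : MvPolynomial (Option β) L) :
    optionEquivLeft L β (pderiv none f) = Polynomial.derivative (optionEquivLeft L β f) := by
  induction f using MvPolynomial.induction_on with
  | C a => simp
  | add p q hp hq => simp [hp, hq]
  | mul_X p o hp =>
    rw [pderiv_mul, map_add, map_mul, map_mul, hp, map_mul, Polynomial.derivative_mul]
    cases o with
    | none => simp
    | some j => simp [pderiv_X_of_ne]

/-- `optionEquivLeft` turns the substitution `y ↦ z` into univariate evaluation. [folklore] -/
private theorem eval_optionEquivLeft_eq_aeval' (H : MvPolynomial (Option β) L)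
    (z : MvPolynomial β L) :
    Polynomial.eval z (optionEquivLeft L β H) = aeval (fun o : Option β => o.elim z X) H := by
  induction H using MvPolynomial.induction_on with
  | C a => simp [optionEquivLeft_C]
  | add p q hp hq => simp only [map_add, Polynomial.eval_add, hp, hq]
  | mul_X p o hp =>
    rcases o with _ | b <;> simp [hp, optionEquivLeft_X_none, optionEquivLeft_X_some]

/-- Change of scalars commutes with `optionEquivLeft`. [folklore] -/
private theorem optionEquivLeft_map' {K : Type w} [CommRing K] (ι : L →+* K)
    (H : MvPolynomial (Option β) L) :
    optionEquivLeft K β (MvPolynomial.map ι H) =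
      Polynomial.map (MvPolynomial.map ι) (optionEquivLeft L β H) := by
  induction H using MvPolynomial.induction_on with
  | C a => simp [optionEquivLeft_C]
  | add p q hp hq => simp only [map_add, Polynomial.map_add, hp, hq]
  | mul_X p o hp =>
    rcases o with _ | b <;> simp [hp, optionEquivLeft_X_none, optionEquivLeft_X_some]

/-- `H(0, a)` two ways: constant term of `H(x, a)` over `K` / evaluation of `H`. [folklore] -/
private theorem constantCoeff_aeval_elim {K : Type w} [CommRing K] [Algebra L K] (a : K)
    (H : MvPolynomial (Option β) L) :
    constantCoeff (aeval (fun o : Option β => o.elim (C a) X)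
      (MvPolynomial.map (algebraMap L K) H)) =
        aeval (fun o : Option β => o.elim a (fun _ => 0)) H := by
  induction H using MvPolynomial.induction_on with
  | C r => simp
  | add p q hp hq => simp only [map_add, hp, hq]
  | mul_X p o hp =>
    simp only [map_mul, map_X, aeval_X, hp]
    rcases o with _ | b <;> simp

/-- Truncations agree when the difference vanishes to the right order. [folklore] -/
private theorem truncation_eq_of_vanish' {D : ℕ} {q g : MvPolynomial β L}
    (h : ∀ k < D + 1, homogeneousComponent k (q - g) = 0) :
    ∑ i ∈ range (D + 1), homogeneousComponent i q =
      ∑ i ∈ range (D + 1), homogeneousComponent i g :=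
  sum_congr rfl fun i hi => by
    have := h i (mem_range.1 hi)
    rwa [map_sub, sub_eq_zero] at this

/-- The truncation of `g` at a degree `≥ deg g` is `g`. [folklore] -/
private theorem truncation_of_totalDegree_le' {D : ℕ} {g : MvPolynomial β L}
    (hD : g.totalDegree ≤ D) : ∑ i ∈ range (D + 1), homogeneousComponent i g = g := by
  calc ∑ i ∈ range (D + 1), homogeneousComponent i g
      = ∑ i ∈ range (g.totalDegree + 1), homogeneousComponent i g := by
        refine (Finset.sum_subset (Finset.range_mono (by omega)) fun i hi hi' => ?_).symm
        refine homogeneousComponent_eq_zero _ _ ?_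
        simp only [mem_range, not_lt] at hi hi'
        omega
    _ = g := sum_homogeneousComponent g

end OptionEquiv

section Laurent
variable {F : Type u} [Field F] {σ : Type v}

/-- Coefficients of a polynomial over `F[x]` read in `F((ε))[x]` are `O(1)`. [folklore] -/
private theorem polyOrdGE_coeff_map' (Q : Polynomial (MvPolynomial σ F)) (i : ℕ) :
    PolyOrdGE 0 ((Q.map (MvPolynomial.map (algebraMap F (LaurentSeries F)))).coeff i) := by
  rw [Polynomial.coeff_map]
  exact PolyOrdGE.map_algebraMap _

/-- `Q(z) = O(1)` for `O(1)` coefficients and argument. [folklore] -/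
private theorem polyOrdGE_eval₀ {Q : Polynomial (MvPolynomial σ (LaurentSeries F))}
    (hQ : ∀ i, PolyOrdGE 0 (Q.coeff i)) {z : MvPolynomial σ (LaurentSeries F)}
    (hz : PolyOrdGE 0 z) : PolyOrdGE 0 (Q.eval z) := by
  rw [Polynomial.eval_eq_sum_range]
  exact PolyOrdGE.sum fun i _ => by simpa using (hQ i).mul (hz.pow i)

/-- `Q(z) - Q(w) = O(ε)` when `z - w = O(ε)` (everything `O(1)`). [folklore] -/
private theorem polyOrdGE_eval_sub₀ {Q : Polynomial (MvPolynomial σ (LaurentSeries F))}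
    (hQ : ∀ i, PolyOrdGE 0 (Q.coeff i)) {z w : MvPolynomial σ (LaurentSeries F)}
    (hz : PolyOrdGE 0 z) (hw : PolyOrdGE 0 w) (hzw : PolyOrdGE 1 (z - w)) :
    PolyOrdGE 1 (Q.eval z - Q.eval w) := by
  have key : Q.eval z - Q.eval w = ∑ i ∈ range (Q.natDegree + 1),
      Q.coeff i * ((∑ j ∈ range i, z ^ j * w ^ (i - 1 - j)) * (z - w)) := by
    rw [Polynomial.eval_eq_sum_range, Polynomial.eval_eq_sum_range, ← Finset.sum_sub_distrib]
    refine Finset.sum_congr rfl fun i _ => ?_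
    rw [Commute.geom_sum₂_mul (Commute.all z w) i, mul_sub]
  rw [key]
  refine PolyOrdGE.sum fun i _ => ?_
  have h1 : PolyOrdGE 0 (∑ j ∈ range i, z ^ j * w ^ (i - 1 - j)) :=
    PolyOrdGE.sum fun j _ => by simpa using (hz.pow j).mul (hw.pow (i - 1 - j))
  simpa using (hQ i).mul (h1.mul hzw)

/-- `u = a + O(ε)` with `a ≠ 0` is a unit of `F[[ε]]`. [folklore] -/
private theorem isOrdGE_inv_of_sub_C' {u : LaurentSeries F} {a : F}
    (h : IsOrdGE 1 (u - HahnSeries.C a)) (ha : a ≠ 0) : u ≠ 0 ∧ IsOrdGE 0 u⁻¹ := by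
  have hu0 : u.coeff 0 = a := by
    have := h 0 zero_lt_one
    rwa [HahnSeries.coeff_sub, HahnSeries.C_apply, HahnSeries.coeff_single_same,
      sub_eq_zero] at this
  have hu : IsOrdGE 0 u := by
    have : u = (u - HahnSeries.C a) + HahnSeries.C a := by ring
    rw [this]
    exact (h.mono zero_le_one).add (IsOrdGE.C a)
  refine ⟨fun h' => ha ?_, isOrdGE_zero_inv hu (by rw [hu0]; exact ha)⟩
  rw [← hu0, h', HahnSeries.coeff_zero]

end Laurent

section Core
variable {F : Type u} [Field F] {β : Type v}

/-- **The perturbed polynomial `G(x, y) = H(x, y + ε) - c₀ ∈ F((ε))[x][y]`**: `F[[ε]][x]`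
coefficients, `y`-degree `≤ deg_y H`, evaluations as shown. [cite: Burgisser2004Factors, §3.2] -/
theorem exists_perturbedPolynomial (H : MvPolynomial (Option β) F) (c : F)
    {ε c₀ : LaurentSeries F} (hε : ε = HahnSeries.single 1 1)
    (hc₀ : c₀ = aeval (fun o : Option β =>
      o.elim (algebraMap F (LaurentSeries F) c + ε) (fun _ => 0)) H) :
    ∃ PG : Polynomial (MvPolynomial β (LaurentSeries F)),
      (∀ i, PolyOrdGE 0 (PG.coeff i)) ∧ PG.natDegree ≤ (optionEquivLeft F β H).natDegree ∧
      ∀ z, PG.eval z = aeval (fun o : Option β => o.elim (z + C ε) X)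
        (MvPolynomial.map (algebraMap F (LaurentSeries F)) H) - C c₀ := by
  set ι : F →+* LaurentSeries F := algebraMap F (LaurentSeries F) with hι
  set P : Polynomial (MvPolynomial β (LaurentSeries F)) :=
    optionEquivLeft _ β (MvPolynomial.map ι H) with hP
  have hPmap : P = Polynomial.map (MvPolynomial.map ι) (optionEquivLeft F β H) :=
    optionEquivLeft_map' ι H
  have hPi : ∀ i, PolyOrdGE 0 (P.coeff i) := fun i => by
    rw [hPmap]; exact polyOrdGE_coeff_map' _ i
  have hε0 : IsOrdGE 0 ε := by rw [hε]; exact (IsOrdGE.single 1 (1 : F)).mono zero_le_one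
  have hCε : PolyOrdGE 0 (C ε : MvPolynomial β (LaurentSeries F)) := PolyOrdGE.C hε0
  have hPeval : ∀ w, P.eval w = aeval (fun o : Option β => o.elim w X) (MvPolynomial.map ι H) :=
    fun w => eval_optionEquivLeft_eq_aeval' _ w
  have hc₀0 : IsOrdGE 0 c₀ := by
    have h1 : c₀ = coeff 0 (P.eval (C (ι c + ε))) := by
      rw [hPeval, ← constantCoeff_eq, constantCoeff_aeval_elim, hc₀]
    rw [h1]
    refine polyOrdGE_eval₀ hPi ?_ 0
    rw [map_add, hι, algebraMap_laurentSeries_apply]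
    exact (PolyOrdGE.C (IsOrdGE.C c)).add hCε
  refine ⟨P.comp (Polynomial.X + Polynomial.C (C ε)) - Polynomial.C (C c₀), fun i => ?_, ?_,
    fun z => ?_⟩
  · rw [Polynomial.coeff_sub, Polynomial.coeff_C, Polynomial.comp_eq_sum_left, Polynomial.sum_def,
      Polynomial.finsetSum_coeff]
    refine PolyOrdGE.sub (PolyOrdGE.sum fun n _ => ?_) ?_
    · rw [Polynomial.coeff_C_mul, Polynomial.coeff_X_add_C_pow]
      have hnat := PolyOrdGE.C (σ := β) (IsOrdGE.C ((n.choose i : ℕ) : F))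
      rw [map_natCast, map_natCast] at hnat
      simpa using (hPi n).mul ((hCε.pow (n - i)).mul hnat)
    · split_ifs
      · exact PolyOrdGE.C hc₀0
      · exact PolyOrdGE.zero 0
  · rw [Polynomial.natDegree_sub_C]
    calc (P.comp (Polynomial.X + Polynomial.C (C ε))).natDegree
        ≤ P.natDegree * (Polynomial.X + Polynomial.C (C ε)).natDegree :=
          Polynomial.natDegree_comp_le
      _ = P.natDegree := by rw [Polynomial.natDegree_X_add_C, mul_one]
      _ ≤ (optionEquivLeft F β H).natDegree := by rw [hPmap]; exact Polynomial.natDegree_map_le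
  · rw [Polynomial.eval_sub, Polynomial.eval_comp, Polynomial.eval_add, Polynomial.eval_X,
      Polynomial.eval_C, Polynomial.eval_C, hPeval]

/-- **Bürgisser's approximative root lifting at a good point, data-explicit.** If `H ∈ F[x][y]`
factors as `(y - φ)^{e+1} · Q` with `Q(x, φ)(0) ≠ 0`, and `c = φ(0)`, `c₀ = H(0, c + ε)`,
`ξ = ∂_y H(0, c + ε)`, then `ξ ≠ 0`, `ξ⁻¹ = O(ε^{-e})`, and for `d ≥ deg φ` the degree-`d`
truncation of the `d`-th Newton iterate `z ↦ z - ξ⁻¹ (H(x, z + ε) - c₀)` from `c` is `φ + O(ε)`.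
[cite: Burgisser2004Factors, Prop. 3.4, Remark 1(1) (arXiv:1812.06828 §3.2)] -/
theorem newton_truncation_polyOrdGE [CharZero F] (H : MvPolynomial (Option β) F)
    (φ : MvPolynomial β F) {e : ℕ} (Q : Polynomial (MvPolynomial β F))
    (hfac : optionEquivLeft F β H = (Polynomial.X - Polynomial.C φ) ^ (e + 1) * Q)
    (hq : coeff 0 (Q.eval φ) ≠ 0) {d : ℕ} (hd : φ.totalDegree ≤ d)
    {ε c₀ ξ : LaurentSeries F} (hε : ε = HahnSeries.single 1 1)
    (hc₀ : c₀ = aeval (fun o : Option β =>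
      o.elim (algebraMap F (LaurentSeries F) (coeff 0 φ) + ε) (fun _ => 0)) H)
    (hξ : ξ = aeval (fun o : Option β =>
      o.elim (algebraMap F (LaurentSeries F) (coeff 0 φ) + ε) (fun _ => 0)) (pderiv none H)) :
    ξ ≠ 0 ∧ IsOrdGE (-(e : ℤ)) ξ⁻¹ ∧
      PolyOrdGE 1 ((∑ i ∈ range (d + 1), homogeneousComponent i
        ((fun z => z - C ξ⁻¹ * (aeval (fun o : Option β => o.elim (z + C ε) X)
            (MvPolynomial.map (algebraMap F (LaurentSeries F)) H) - C c₀))^[d]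
          (C (algebraMap F (LaurentSeries F) (coeff 0 φ))))) -
        MvPolynomial.map (algebraMap F (LaurentSeries F)) φ) := by
  classical
  set ι : F →+* LaurentSeries F := algebraMap F (LaurentSeries F) with hι
  have hε1 : IsOrdGE 1 ε := by rw [hε]; exact IsOrdGE.single 1 (1 : F)
  have hεne : ε ≠ 0 := by rw [hε]; exact HahnSeries.single_ne_zero one_ne_zero
  set Hk : MvPolynomial (Option β) (LaurentSeries F) := MvPolynomial.map ι H with hHk
  set φk : MvPolynomial β (LaurentSeries F) := MvPolynomial.map ι φ with hφk
  set Qk : Polynomial (MvPolynomial β (LaurentSeries F)) := Q.map (MvPolynomial.map ι) with hQk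
  set P : Polynomial (MvPolynomial β (LaurentSeries F)) := optionEquivLeft _ β Hk with hPdef
  have hP : P = (Polynomial.X - Polynomial.C φk) ^ (e + 1) * Qk := by
    rw [hPdef, hHk, optionEquivLeft_map', hfac, Polynomial.map_mul, Polynomial.map_pow,
      Polynomial.map_sub, Polynomial.map_X, Polynomial.map_C]
  have hφk0 : PolyOrdGE 0 φk := PolyOrdGE.map_algebraMap φ
  have hQk0 : ∀ i, PolyOrdGE 0 (Qk.coeff i) := polyOrdGE_coeff_map' Q
  have hQk'0 : ∀ i, PolyOrdGE 0 ((Polynomial.derivative Qk).coeff i) := by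
    rw [hQk, Polynomial.derivative_map]
    exact polyOrdGE_coeff_map' _
  have hdegk : φk.totalDegree ≤ d := le_trans (Finset.sup_mono (support_map_subset ι φ)) hd
  set cK : LaurentSeries F := ι (coeff 0 φ) with hcK
  have hcKφ : coeff 0 φk = cK := by rw [hφk, coeff_map]
  set qF : F := coeff 0 (Q.eval φ) with hqF
  set κ : LaurentSeries F := coeff 0 (Qk.eval (φk + C ε)) with hκ
  set κ' : LaurentSeries F := coeff 0 ((Polynomial.derivative Qk).eval (φk + C ε)) with hκ'
  set u : LaurentSeries F := ((e + 1 : ℕ) : LaurentSeries F) * κ + ε * κ' with hu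
  have hCε : PolyOrdGE 1 (C ε : MvPolynomial β (LaurentSeries F)) := PolyOrdGE.C hε1
  have hφkε : PolyOrdGE 0 (φk + C ε) := hφk0.add (hCε.mono zero_le_one)
  have hκ0 : IsOrdGE 0 κ := polyOrdGE_eval₀ hQk0 hφkε 0
  have hκ'0 : IsOrdGE 0 κ' := polyOrdGE_eval₀ hQk'0 hφkε 0
  have hQkφk : Qk.eval φk = MvPolynomial.map ι (Q.eval φ) := by
    rw [hQk, hφk, Polynomial.eval_map, Polynomial.eval₂_hom]
  have hκq : IsOrdGE 1 (κ - HahnSeries.C qF) := by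
    have h1 : HahnSeries.C qF = coeff 0 (Qk.eval φk) := by
      rw [hQkφk, coeff_map, ← hqF, hι, algebraMap_laurentSeries_apply]
    rw [h1, hκ, ← coeff_sub]
    refine (polyOrdGE_eval_sub₀ hQk0 hφkε hφk0 ?_) 0
    rw [add_sub_cancel_left]
    exact hCε
  have hu1 : IsOrdGE 1 (u - HahnSeries.C (((e + 1 : ℕ) : F) * qF)) := by
    have : u - HahnSeries.C (((e + 1 : ℕ) : F) * qF) =
        HahnSeries.C ((e + 1 : ℕ) : F) * (κ - HahnSeries.C qF) + ε * κ' := by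
      rw [hu, map_mul, map_natCast]; ring
    rw [this]
    have h1 := (IsOrdGE.C ((e + 1 : ℕ) : F)).mul hκq
    have h2 := hε1.mul hκ'0
    simp only [zero_add, add_zero] at h1 h2
    exact h1.add h2
  have heq : ((e + 1 : ℕ) : F) * qF ≠ 0 := mul_ne_zero (Nat.cast_ne_zero.2 (by omega)) hq
  obtain ⟨hu0, huinv⟩ := isOrdGE_inv_of_sub_C' hu1 heq
  set PG : Polynomial (MvPolynomial β (LaurentSeries F)) :=
    P.comp (Polynomial.X + Polynomial.C (C ε)) - Polynomial.C (C c₀) with hPG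
  have hPGeval : ∀ z, PG.eval z = P.eval (z + C ε) - C c₀ := fun z => by
    rw [hPG, Polynomial.eval_sub, Polynomial.eval_comp, Polynomial.eval_add, Polynomial.eval_X,
      Polynomial.eval_C, Polynomial.eval_C]
  have hPG'eval : ∀ z, (Polynomial.derivative PG).eval z =
      (Polynomial.derivative P).eval (z + C ε) := fun z => by
    rw [hPG, Polynomial.derivative_sub, Polynomial.derivative_C, sub_zero,
      Polynomial.derivative_comp, Polynomial.derivative_add, Polynomial.derivative_X,
      Polynomial.derivative_C, add_zero, one_mul, Polynomial.eval_comp, Polynomial.eval_add,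
      Polynomial.eval_X, Polynomial.eval_C]
  have hPaeval : ∀ w, aeval (fun o : Option β => o.elim w X) Hk = P.eval w :=
    fun w => (eval_optionEquivLeft_eq_aeval' Hk w).symm
  have hPGeval' : ∀ w, P.eval (w + C ε) - C c₀ = PG.eval w := fun w => (hPGeval w).symm
  simp only [hPaeval, hPGeval']
  have hc₀' : coeff 0 (P.eval (C cK + C ε)) = c₀ := by
    rw [← hPaeval, ← map_add, ← constantCoeff_eq, constantCoeff_aeval_elim, hc₀]
  have hP' : Polynomial.derivative P =
      optionEquivLeft _ β (MvPolynomial.map ι (pderiv none H)) := by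
    rw [hPdef, ← optionEquivLeft_pderiv_none', hHk, pderiv_map]
  have hξ' : coeff 0 ((Polynomial.derivative PG).eval (C cK)) = ξ := by
    rw [hPG'eval, hP', eval_optionEquivLeft_eq_aeval', ← map_add, ← constantCoeff_eq,
      constantCoeff_aeval_elim, hξ]
  have hstart : coeff 0 (PG.eval (C cK)) = 0 := by
    rw [hPGeval, coeff_sub, hc₀', coeff_zero_C, sub_self]
  have hcKφ' : constantCoeff φk = cK := by rw [constantCoeff_eq, hcKφ]
  have hevc : ∀ S : Polynomial (MvPolynomial β (LaurentSeries F)),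
      coeff 0 (S.eval (C cK + C ε)) = coeff 0 (S.eval (φk + C ε)) := fun S => by
    simp only [← constantCoeff_eq, ← Polynomial.eval₂_at_apply constantCoeff, map_add,
      constantCoeff_C, hcKφ']
  have hPline : ∀ v : MvPolynomial β (LaurentSeries F),
      P.eval (φk + C ε * v) = C (ε ^ (e + 1)) * (v ^ (e + 1) * Qk.eval (φk + C ε * v)) := by
    intro v
    rw [hP, Polynomial.eval_mul, Polynomial.eval_pow, Polynomial.eval_sub, Polynomial.eval_X,
      Polynomial.eval_C, add_sub_cancel_left, mul_pow, C_pow]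
    ring
  have hP'line : (Polynomial.derivative P).eval (φk + C ε) =
      ((e + 1 : ℕ) : MvPolynomial β (LaurentSeries F)) * C ε ^ e * Qk.eval (φk + C ε) +
        C ε ^ (e + 1) * (Polynomial.derivative Qk).eval (φk + C ε) := by
    rw [hP, Polynomial.derivative_mul, Polynomial.derivative_pow, Polynomial.derivative_X_sub_C,
      mul_one, Nat.add_sub_cancel]
    simp only [Polynomial.eval_add, Polynomial.eval_mul, Polynomial.eval_pow, Polynomial.eval_sub,
      Polynomial.eval_X, Polynomial.eval_C, add_sub_cancel_left]
  have hc₀κ : c₀ = ε ^ (e + 1) * κ := by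
    rw [← hc₀', hevc P]
    have h2 := hPline 1
    rw [mul_one, one_pow, one_mul] at h2
    rw [h2, coeff_C_mul, hκ]
  have hξu : ξ = ε ^ e * u := by
    rw [← hξ', hPG'eval, hevc, hP'line, hu, hκ, hκ']
    rw [← constantCoeff_eq, map_add, map_mul, map_mul, map_mul, map_pow, map_pow, map_natCast,
      constantCoeff_C, constantCoeff_eq]
    ring
  have hξ0 : ξ ≠ 0 := by
    rw [hξu]; exact mul_ne_zero (pow_ne_zero _ hεne) hu0
  have hξinv : IsOrdGE (-(e : ℤ)) ξ⁻¹ := by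
    have h1 : (ε ^ e)⁻¹ = HahnSeries.single (-(e : ℤ)) (1 : F) := by
      rw [hε, HahnSeries.single_pow, one_pow, HahnSeries.inv_single, inv_one, nsmul_eq_mul, mul_one]
    rw [hξu, mul_inv, h1]
    simpa using (IsOrdGE.single (-(e : ℤ)) (1 : F)).mul huinv
  set R : Polynomial (MvPolynomial β (LaurentSeries F)) :=
    Polynomial.X ^ (e + 1) * Qk.comp (Polynomial.C φk + Polynomial.C (C ε) * Polynomial.X) -
      Polynomial.C (C κ) with hR
  have hReval : ∀ v, R.eval v = v ^ (e + 1) * Qk.eval (φk + C ε * v) - C κ := fun v => by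
    rw [hR, Polynomial.eval_sub, Polynomial.eval_mul, Polynomial.eval_pow, Polynomial.eval_X,
      Polynomial.eval_comp, Polynomial.eval_add, Polynomial.eval_mul, Polynomial.eval_C,
      Polynomial.eval_C, Polynomial.eval_X, Polynomial.eval_C]
  have hRint : ∀ v, PolyOrdGE 0 v → PolyOrdGE 0 (R.eval v) := fun v hv => by
    rw [hReval]
    refine PolyOrdGE.sub ?_ (PolyOrdGE.C hκ0)
    have h1 : PolyOrdGE 0 (φk + C ε * v) :=
      hφk0.add (by simpa using (hCε.mono zero_le_one).mul hv)
    simpa using (hv.pow (e + 1)).mul (polyOrdGE_eval₀ hQk0 h1)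
  have hRstart : coeff 0 (R.eval (C 1)) = 0 := by
    rw [hReval, C_1, one_pow, one_mul, mul_one, coeff_sub, coeff_C, if_pos rfl, hκ, sub_self]
  have hR'1 : coeff 0 ((Polynomial.derivative R).eval (C 1)) = u := by
    have hd1 : Polynomial.derivative R =
        Polynomial.C ((e + 1 : ℕ) : MvPolynomial β (LaurentSeries F)) * Polynomial.X ^ e *
            Qk.comp (Polynomial.C φk + Polynomial.C (C ε) * Polynomial.X) +
          Polynomial.X ^ (e + 1) * (Polynomial.C (C ε) *
            (Polynomial.derivative Qk).comp
              (Polynomial.C φk + Polynomial.C (C ε) * Polynomial.X)) := by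
      rw [hR, Polynomial.derivative_sub, Polynomial.derivative_C, sub_zero,
        Polynomial.derivative_mul, Polynomial.derivative_X_pow, Nat.add_sub_cancel,
        Polynomial.derivative_comp, Polynomial.derivative_add, Polynomial.derivative_C, zero_add,
        Polynomial.derivative_C_mul_X]
    rw [hd1]
    simp only [Polynomial.eval_add, Polynomial.eval_mul, Polynomial.eval_C, Polynomial.eval_pow,
      Polynomial.eval_X, Polynomial.eval_comp, C_1, one_pow, mul_one, one_mul]
    rw [hu, hκ, hκ', ← constantCoeff_eq, map_add, map_mul, map_mul, map_natCast, constantCoeff_C,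
      constantCoeff_eq]
  have hGline : ∀ v, PG.eval (φk - C ε + C ε * v) = C (ε ^ (e + 1)) * R.eval v := fun v => by
    rw [hPGeval, hReval, hc₀κ, C_mul]
    have : φk - C ε + C ε * v + C ε = φk + C ε * v := by ring
    rw [this, hPline]
    ring
  obtain ⟨hz1, hzP⟩ := newton_iterate_residual_vanish PG cK hstart hξ' hξ0 d
  set z : MvPolynomial β (LaurentSeries F) :=
    (fun z => z - C ξ⁻¹ * PG.eval z)^[d] (C cK) with hz
  obtain ⟨hv1, hvR⟩ := newton_iterate_residual_vanish R 1 hRstart hR'1 hu0 d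
  set v : MvPolynomial β (LaurentSeries F) := (fun v => v - C u⁻¹ * R.eval v)^[d] (C 1) with hv
  have hvint : PolyOrdGE 0 v := polyOrdGE_newton_iterate hRint huinv d
  have hzh1 : ∀ k < 1, homogeneousComponent k (φk - C ε + C ε * v - C cK) = 0 := by
    have hv0 := hv1 0 zero_lt_one
    rw [homogeneousComponent_zero, C_eq_zero, coeff_sub, coeff_zero_C, sub_eq_zero] at hv0
    intro k hk
    obtain rfl : k = 0 := by omega
    rw [homogeneousComponent_zero, C_eq_zero, coeff_sub, coeff_add, coeff_sub, coeff_C_mul,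
      coeff_zero_C, coeff_zero_C, hcKφ, hv0]
    ring
  have hzhP : ∀ k < d + 1, homogeneousComponent k (PG.eval (φk - C ε + C ε * v)) = 0 :=
    fun k hk => by rw [hGline, homogeneousComponent_C_mul, hvR k hk, mul_zero]
  have hzzh : ∀ k < d + 1, homogeneousComponent k (z - (φk - C ε + C ε * v)) = 0 :=
    vanish_sub_of_approxRoots PG cK hξ' hξ0 hz1 hzh1 hzP hzhP
  refine ⟨hξ0, hξinv, ?_⟩
  rw [truncation_eq_of_vanish' hzzh]
  have hsplit : φk - C ε + C ε * v = φk + C ε * (v - 1) := by ring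
  rw [hsplit]
  simp only [map_add, Finset.sum_add_distrib]
  rw [truncation_of_totalDegree_le' hdegk, add_sub_cancel_left]
  simp only [homogeneousComponent_C_mul, ← Finset.mul_sum]
  simpa using hCε.mul (polyOrdGE_truncation (hvint.sub PolyOrdGE.one) d)

end Core

end Summit.ValiantsHypothesis.ValiantsHypothesis.Theorems.VPBoundarySquareRootsNewtonCore
end
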